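import Literature.Computability.Cryptography.KitaevPhaseEstimationCircuit
import HarnessLib

/-!
# Kitaev's eigenvalue measurement, IV: quantum-state encodings of the work register

Topic `Literature/Computability/Cryptography`; sequel of `KitaevPhaseEstimationCircuit.lean`
(Kitaev 1995, §3). There the classical block `V` of Kitaev's circuit `kitaevCircuit V σ` is
assumed to write a *basis state* on the work register, `V |x y 0^m⟩ = |x y (R y)⟩`
(`Kitaev1995.kitaevCircuit_runOn`). For a black-box group without unique classical encodings of
its elements (e.g. the class group of a number field of unit rank `≥ 1`, where an ideal class has
no canonical reduced representative, so the block writes the uniform superposition over the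
reduced ideals of the class) the block writes a general *state* `Φ y` of the work register:
`V |x y 0^m⟩ = |x⟩ ⊗ |y⟩ ⊗ Φ y`. This file redoes the amplitude computation of Kitaev's circuit
in that generality — only linearity in the work register is added:

* `triState x y φ = |x⟩ ⊗ |y⟩ ⊗ φ` (`= ∑_ρ φ ρ • |x y ρ⟩`, `triState_eq_sum`;
  `triState x y |ρ⟩ = |x y ρ⟩`, `triState_basisState`);
* the layers on such states (`phaseLayer_mulVec_triState`, `hadamardLayer_mulVec_triState`);
* **`kitaevCircuit_runOn_state`** — the output state
  `2^{-k} ∑_{y,y'} (-i)^{#σ∧y} (-1)^{y·y'} |x⟩|y'⟩ Φ y`, its amplitudes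
  `ψ(x γ ρ) = 2^{-k} ∑_y (-i)^{#σ∧y} (-1)^{y·γ} Φ y ρ` (`kitaevCircuit_runOn_state_tri`), their
  vanishing off `x` (`kitaevCircuit_runOn_state_of_ne`);
* the Born probability of a control event (`sum_controls_eq_of_vanish_off`,
  `kitaevCircuit_prob_controls_state`, `kitaevCircuit_prob_controls_state_eq`):
  `∑_{z : controls ∈ E} |ψ z|² = ∑_{γ ∈ E} ∑_ρ |ψ(x γ ρ)|² = 4^{-k} ∑_{γ∈E} ∑_ρ |∑_y (-i)^{#σ∧y} (-1)^{y·γ} Φ y ρ|²`.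

The outcome *distribution* for class-orthonormal encodings and its stability under small
perturbations of `Φ` are in `KitaevStateEncodingsSums.lean` / `KitaevStateEncodingsSuccess.lean`.

## References

* A. Yu. Kitaev, *Quantum measurements and the Abelian Stabilizer Problem*,
  arXiv:quant-ph/9511026 (1995), §3 (Remark 8, Lemma 8, Lemma 10), §4 [Kitaev1995].
* M. A. Nielsen, I. L. Chuang, *Quantum Computation and Quantum Information*, CUP 2010, §1.4.4,
  eq. (1.50) [NielsenChuang2010].
-/

noncomputable section

namespace Literature.Computability.Cryptography

namespace Kitaev1995

open _root_.Computability Complexity QuantumComplexity Matrix Finset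

/-! ### The state `|x⟩ ⊗ |y⟩ ⊗ φ` -/

section layout

variable {n k m : ℕ}

/-- The state `|x⟩ ⊗ |y⟩ ⊗ φ` of a register with `n` input wires, `k` control wires and `m` work
wires: the vector supported on the labels `x y ρ`, with value `φ ρ` there. [folklore] -/
def triState (x : QReg n) (y : QReg k) (φ : QReg m → ℂ) : QReg (n + (k + m)) → ℂ :=
  fun z => if (fun i => z (Fin.castAdd (k + m) i)) = x ∧ (fun j => z (coinWire n k m j)) = y then
    φ (fun l => z (Fin.natAdd n (Fin.natAdd k l))) else 0

/-- The amplitudes of `|x⟩ ⊗ |y⟩ ⊗ φ` on the labels `x' y' ρ`. [folklore] -/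
theorem triState_tri (x x' : QReg n) (y y' : QReg k) (φ : QReg m → ℂ) (ρ : QReg m) :
    triState x y φ (tri x' y' ρ) = if x' = x ∧ y' = y then φ ρ else 0 := by
  unfold triState
  have h1 : (fun i => tri x' y' ρ (Fin.castAdd (k + m) i)) = x' := funext fun i => tri_castAdd _ _ _ i
  have h2 : (fun j => tri x' y' ρ (coinWire n k m j)) = y' := funext fun j => tri_coinWire _ _ _ j
  have h3 : (fun l => tri x' y' ρ (Fin.natAdd n (Fin.natAdd k l))) = ρ :=
    funext fun l => tri_work _ _ _ l
  rw [h1, h2, h3]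

/-- `|x⟩ ⊗ |y⟩ ⊗ φ = ∑_ρ φ ρ • |x y ρ⟩`. [folklore] -/
theorem triState_eq_sum (x : QReg n) (y : QReg k) (φ : QReg m → ℂ) :
    triState x y φ = ∑ ρ : QReg m, φ ρ • basisState (tri x y ρ) := by
  classical
  ext z
  obtain ⟨⟨x', y', ρ'⟩, rfl⟩ := (triEquiv n k m).surjective z
  change triState x y φ (tri x' y' ρ') = (∑ ρ : QReg m, φ ρ • basisState (tri x y ρ)) (tri x' y' ρ')
  rw [triState_tri]
  simp only [Finset.sum_apply, Pi.smul_apply, smul_eq_mul, basisState_apply, tri_eq_tri_iff]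
  by_cases h : x' = x ∧ y' = y
  · rw [if_pos h, Finset.sum_eq_single ρ']
    · rw [if_pos ⟨h.1, h.2, rfl⟩, mul_one]
    · intro ρ _ hρ
      rw [if_neg (fun h' => hρ h'.2.2.symm), mul_zero]
    · intro h'; exact absurd (Finset.mem_univ _) h'
  · rw [if_neg h]
    exact (Finset.sum_eq_zero fun ρ _ => by
      rw [if_neg (fun h' => h ⟨h'.1, h'.2.1⟩), mul_zero]).symm

/-- Basis-state encodings are the special case `φ = |ρ⟩`: `|x⟩ ⊗ |y⟩ ⊗ |ρ⟩ = |x y ρ⟩`. [folklore] -/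
theorem triState_basisState (x : QReg n) (y : QReg k) (ρ : QReg m) :
    triState x y (basisState ρ) = basisState (tri x y ρ) := by
  ext z
  obtain ⟨⟨x', y', ρ'⟩, rfl⟩ := (triEquiv n k m).surjective z
  change triState x y _ (tri x' y' ρ') = basisState (tri x y ρ) (tri x' y' ρ')
  rw [triState_tri, basisState_apply, basisState_apply]
  simp only [tri_eq_tri_iff]
  by_cases h : x' = x ∧ y' = y
  · rw [if_pos h]
    by_cases h3 : ρ' = ρ
    · rw [if_pos h3, if_pos ⟨h.1, h.2, h3⟩]
    · rw [if_neg h3, if_neg (fun h' => h3 h'.2.2)]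
  · rw [if_neg h, if_neg (fun h' => h ⟨h'.1, h'.2.1⟩)]

/-- `triState x y` is additive in the work-register state. [folklore] -/
theorem triState_add (x : QReg n) (y : QReg k) (φ φ' : QReg m → ℂ) :
    triState x y (φ + φ') = triState x y φ + triState x y φ' := by
  ext z
  simp only [triState, Pi.add_apply]
  split_ifs <;> simp

/-- `triState x y` is homogeneous in the work-register state. [folklore] -/
theorem triState_smul (x : QReg n) (y : QReg k) (c : ℂ) (φ : QReg m → ℂ) :
    triState x y (c • φ) = c • triState x y φ := by
  ext z
  simp only [triState, Pi.smul_apply, smul_eq_mul]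
  split_ifs <;> simp

/-- `triState x y` commutes with finite sums of work-register states. [folklore] -/
theorem triState_sum {ι : Type*} (s : Finset ι) (x : QReg n) (y : QReg k)
    (φ : ι → QReg m → ℂ) :
    triState x y (∑ i ∈ s, φ i) = ∑ i ∈ s, triState x y (φ i) := by
  classical
  induction s using Finset.induction_on with
  | empty =>
    ext z
    simp [triState]
  | insert i s hi ih => rw [sum_insert hi, sum_insert hi, triState_add, ih]

end layout

/-! ### The layers of Kitaev's circuit on `|x⟩ ⊗ |y⟩ ⊗ φ` -/

section layers

variable {n k m : ℕ}

/-- **The phase layer on `|x⟩ ⊗ |y⟩ ⊗ φ`**: multiplication by `sPhase σ y = (-i)^{#{j : σ j ∧ y j}}`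
(linearity from `phaseLayer_mulVec_tri`). [cite: Kitaev1995, §3 Remark 8] -/
theorem phaseLayer_mulVec_triState (σ : Fin k → Bool) (x : QReg n) (y : QReg k)
    (φ : QReg m → ℂ) :
    (⟨phaseLayer n k m σ⟩ : QCircuit cliffordT _).toMatrix 0 *ᵥ triState x y φ =
      sPhase σ y • triState x y φ := by
  rw [triState_eq_sum, Matrix.mulVec_sum, Finset.smul_sum]
  refine Finset.sum_congr rfl fun ρ _ => ?_
  rw [Matrix.mulVec_smul, phaseLayer_mulVec_tri, smul_comm]

/-- **The Hadamard layer on `|x⟩ ⊗ |y⟩ ⊗ φ`**: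
`H_controls (|x⟩|y⟩φ) = 2^{-k/2} ∑_{y'} (-1)^{y·y'} |x⟩|y'⟩φ` (linearity from
`hadamardLayer_mulVec_tri`). [cite: NielsenChuang2010, §1.4.4] -/
theorem hadamardLayer_mulVec_triState (x : QReg n) (y : QReg k) (φ : QReg m → ℂ) :
    (⟨hadamardLayer n k m⟩ : QCircuit cliffordT (n + (k + m))).toMatrix 0 *ᵥ triState x y φ =
      invSqrt2 ^ k • ∑ y' : QReg k, ySign y y' • triState x y' φ := by
  rw [triState_eq_sum, Matrix.mulVec_sum]
  simp_rw [Matrix.mulVec_smul, hadamardLayer_mulVec_tri, triState_eq_sum, Finset.smul_sum,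
    smul_smul]
  rw [Finset.sum_comm]
  refine Finset.sum_congr rfl fun y' _ => Finset.sum_congr rfl fun ρ _ => ?_
  congr 1
  ring

end layers

/-! ### Kitaev's circuit around a block with state encodings -/

section circuit

variable {n k m : ℕ}

/-- **The output state of Kitaev's circuit** on `|x⟩|0^k⟩|0^m⟩`, for a block acting as
`|x y 0^m⟩ ↦ |x⟩ ⊗ |y⟩ ⊗ Φ y` with arbitrary work-register states `Φ y`:
`2^{-k} ∑_{y, y'} (-i)^{#σ∧y} (-1)^{y·y'} |x⟩|y'⟩ Φ y` (the state form of
`kitaevCircuit_runOn`). [cite: Kitaev1995, §3 (Remark 8, Lemma 8)] -/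
theorem kitaevCircuit_runOn_state (V : QCircuit cliffordT (n + (k + m))) (σ : Fin k → Bool)
    (x : QReg n) (Φ : QReg k → QReg m → ℂ)
    (hV : ∀ y : QReg k, V.toMatrix 0 *ᵥ basisState (coinInput x y) = triState x y (Φ y)) :
    (kitaevCircuit V σ).runOn 0 (basisState (padInput x (k + m))) =
      (invSqrt2 ^ k * invSqrt2 ^ k) •
        ∑ y : QReg k, ∑ y' : QReg k, (sPhase σ y * ySign y y') • triState x y' (Φ y) := by
  have hsplit : kitaevCircuit V σ =
      ((((⟨hadamardLayer n k m⟩ : QCircuit cliffordT _).append V).append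
        ⟨phaseLayer n k m σ⟩).append ⟨hadamardLayer n k m⟩) := by
    simp [kitaevCircuit, QCircuit.append]
  rw [QCircuit.runOn, hsplit, QCircuit.toMatrix_append, QCircuit.toMatrix_append,
    QCircuit.toMatrix_append, ← Matrix.mulVec_mulVec, ← Matrix.mulVec_mulVec,
    ← Matrix.mulVec_mulVec, hadamardLayer_mulVec_padInput, Matrix.mulVec_smul, Matrix.mulVec_sum,
    Finset.sum_congr rfl fun y _ => hV y, Matrix.mulVec_smul, Matrix.mulVec_sum,
    Finset.sum_congr rfl fun y _ => phaseLayer_mulVec_triState σ x y (Φ y), Matrix.mulVec_smul,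
    Matrix.mulVec_sum]
  simp_rw [Matrix.mulVec_smul, hadamardLayer_mulVec_triState, smul_smul, Finset.smul_sum,
    smul_smul]
  refine Finset.sum_congr rfl fun y _ => Finset.sum_congr rfl fun y' _ => ?_
  congr 1
  ring

/-- **The output amplitudes of Kitaev's circuit with state encodings** on the labels `x γ ρ`:
`ψ(x γ ρ) = 2^{-k} ∑_y (-i)^{#σ∧y} (-1)^{y·γ} (Φ y)(ρ)`. [cite: Kitaev1995, §3 (Remark 8, Lemma 8)] -/
theorem kitaevCircuit_runOn_state_tri (V : QCircuit cliffordT (n + (k + m))) (σ : Fin k → Bool)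
    (x : QReg n) (Φ : QReg k → QReg m → ℂ)
    (hV : ∀ y : QReg k, V.toMatrix 0 *ᵥ basisState (coinInput x y) = triState x y (Φ y))
    (γ : QReg k) (ρ : QReg m) :
    (kitaevCircuit V σ).runOn 0 (basisState (padInput x (k + m))) (tri x γ ρ) =
      (invSqrt2 ^ k * invSqrt2 ^ k) * ∑ y : QReg k, sPhase σ y * ySign y γ * Φ y ρ := by
  classical
  rw [kitaevCircuit_runOn_state V σ x Φ hV]
  simp only [Pi.smul_apply, Finset.sum_apply, smul_eq_mul, triState_tri, true_and]
  congr 1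
  refine Finset.sum_congr rfl fun y _ => ?_
  rw [Finset.sum_eq_single γ]
  · rw [if_pos rfl]
  · intro y' _ hy'
    rw [if_neg (fun h => hy' h.symm), mul_zero]
  · intro h; exact absurd (Finset.mem_univ _) h

/-- Off the labels `x γ ρ` the output amplitude of Kitaev's circuit with state encodings
vanishes. [folklore] -/
theorem kitaevCircuit_runOn_state_of_ne (V : QCircuit cliffordT (n + (k + m))) (σ : Fin k → Bool)
    (x : QReg n) (Φ : QReg k → QReg m → ℂ)
    (hV : ∀ y : QReg k, V.toMatrix 0 *ᵥ basisState (coinInput x y) = triState x y (Φ y))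
    (x' : QReg n) (hx : x' ≠ x) (γ : QReg k) (ρ : QReg m) :
    (kitaevCircuit V σ).runOn 0 (basisState (padInput x (k + m))) (tri x' γ ρ) = 0 := by
  classical
  rw [kitaevCircuit_runOn_state V σ x Φ hV]
  simp only [Pi.smul_apply, Finset.sum_apply, smul_eq_mul, triState_tri]
  rw [Finset.sum_eq_zero fun y _ => Finset.sum_eq_zero fun y' _ => by
    rw [if_neg (fun h => hx h.1), mul_zero], mul_zero]

/-- **Probability of a control event, for a state vanishing off the input `x`.** If `ψ` vanishes
on all labels `x' γ ρ` with `x' ≠ x`, the Born probability that the control wires read a string in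
`E` is `∑_{γ ∈ E} ∑_ρ |ψ(x γ ρ)|²`. [folklore] -/
theorem sum_controls_eq_of_vanish_off (ψ : QReg (n + (k + m)) → ℂ) (x : QReg n)
    (hψ : ∀ x', x' ≠ x → ∀ (γ : QReg k) (ρ : QReg m), ψ (tri x' γ ρ) = 0)
    (E : Finset (QReg k)) :
    ∑ z ∈ univ.filter (fun z : QReg (n + (k + m)) => (fun j => z (coinWire n k m j)) ∈ E),
        ‖ψ z‖ ^ 2 = ∑ γ ∈ E, ∑ ρ : QReg m, ‖ψ (tri x γ ρ)‖ ^ 2 := by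
  classical
  rw [Finset.sum_filter, ← Fintype.sum_equiv (triEquiv n k m)
    (fun p => if (fun j => (triEquiv n k m p) (coinWire n k m j)) ∈ E then
      ‖ψ (triEquiv n k m p)‖ ^ 2 else 0) _ (fun p => rfl)]
  rw [Fintype.sum_prod_type, Fintype.sum_eq_single x]
  · rw [Fintype.sum_prod_type]
    have h1 : ∀ (γ : QReg k) (ρ : QReg m), (triEquiv n k m) (x, γ, ρ) = tri x γ ρ := fun _ _ => rfl
    simp only [h1, tri_coinWire]
    have h2 : ∀ γ : QReg k, ((fun j => γ j) ∈ E) = (γ ∈ E) := fun γ => rfl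
    simp only [h2, Finset.sum_ite_irrel, Finset.sum_const_zero]
    rw [← Finset.sum_filter, Finset.filter_mem_eq_inter, Finset.univ_inter]
  · intro x' hx'
    rw [Fintype.sum_prod_type]
    refine Finset.sum_eq_zero fun γ _ => Finset.sum_eq_zero fun ρ _ => ?_
    simp only [triEquiv, Equiv.coe_fn_mk]
    rw [hψ x' hx' γ ρ, norm_zero]
    simp

/-- **Probability of a control event (state encodings).** The Born probability that the control
wires of the output of Kitaev's circuit read a string in `E` is `∑_{γ ∈ E} ∑_ρ |ψ(x γ ρ)|²`.
[folklore] -/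
theorem kitaevCircuit_prob_controls_state (V : QCircuit cliffordT (n + (k + m)))
    (σ : Fin k → Bool) (x : QReg n) (Φ : QReg k → QReg m → ℂ)
    (hV : ∀ y : QReg k, V.toMatrix 0 *ᵥ basisState (coinInput x y) = triState x y (Φ y))
    (E : Finset (QReg k)) :
    ∑ z ∈ univ.filter (fun z : QReg (n + (k + m)) => (fun j => z (coinWire n k m j)) ∈ E),
        ‖(kitaevCircuit V σ).runOn 0 (basisState (padInput x (k + m))) z‖ ^ 2 =
      ∑ γ ∈ E, ∑ ρ : QReg m,
        ‖(kitaevCircuit V σ).runOn 0 (basisState (padInput x (k + m))) (tri x γ ρ)‖ ^ 2 :=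
  sum_controls_eq_of_vanish_off _ x (kitaevCircuit_runOn_state_of_ne V σ x Φ hV) E

/-- `|2^{-k/2} · 2^{-k/2}|² = 4^{-k}`. [folklore] -/
theorem norm_sq_invSqrt2_pow_mul_pow (k : ℕ) :
    ‖(invSqrt2 ^ k * invSqrt2 ^ k : ℂ)‖ ^ 2 = (1 / 4 : ℝ) ^ k := by
  rw [invSqrt2_pow_mul_pow, norm_pow, ← pow_mul, mul_comm, pow_mul]
  norm_num

/-- **The squared amplitudes over the work register (state encodings)**: for each control
read-out `γ`, `∑_ρ |ψ(x γ ρ)|² = 4^{-k} ∑_ρ |∑_y (-i)^{#σ∧y} (-1)^{y·γ} (Φ y)(ρ)|²`. [folklore] -/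
theorem kitaevCircuit_sum_work_state (V : QCircuit cliffordT (n + (k + m)))
    (σ : Fin k → Bool) (x : QReg n) (Φ : QReg k → QReg m → ℂ)
    (hV : ∀ y : QReg k, V.toMatrix 0 *ᵥ basisState (coinInput x y) = triState x y (Φ y))
    (γ : QReg k) :
    ∑ ρ : QReg m, ‖(kitaevCircuit V σ).runOn 0 (basisState (padInput x (k + m))) (tri x γ ρ)‖ ^ 2
      = (1 / 4 : ℝ) ^ k * ∑ ρ : QReg m, ‖∑ y : QReg k, sPhase σ y * ySign y γ * Φ y ρ‖ ^ 2 := by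
  rw [Finset.mul_sum]
  refine Finset.sum_congr rfl fun ρ _ => ?_
  rw [kitaevCircuit_runOn_state_tri V σ x Φ hV, norm_mul, mul_pow, norm_sq_invSqrt2_pow_mul_pow]

/-- **Probability of a control event (state encodings), explicit form**:
`∑_{γ ∈ E} ∑_ρ |ψ(x γ ρ)|² = 4^{-k} ∑_{γ ∈ E} ∑_ρ |∑_y (-i)^{#σ∧y} (-1)^{y·γ} (Φ y)(ρ)|²`.
[folklore] -/
theorem kitaevCircuit_prob_controls_state_eq (V : QCircuit cliffordT (n + (k + m)))
    (σ : Fin k → Bool) (x : QReg n) (Φ : QReg k → QReg m → ℂ)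
    (hV : ∀ y : QReg k, V.toMatrix 0 *ᵥ basisState (coinInput x y) = triState x y (Φ y))
    (E : Finset (QReg k)) :
    ∑ γ ∈ E, ∑ ρ : QReg m,
        ‖(kitaevCircuit V σ).runOn 0 (basisState (padInput x (k + m))) (tri x γ ρ)‖ ^ 2 =
      (1 / 4 : ℝ) ^ k *
        ∑ γ ∈ E, ∑ ρ : QReg m, ‖∑ y : QReg k, sPhase σ y * ySign y γ * Φ y ρ‖ ^ 2 := by
  rw [Finset.mul_sum]
  exact Finset.sum_congr rfl fun γ _ => kitaevCircuit_sum_work_state V σ x Φ hV γ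

end circuit

end Kitaev1995

end Literature.Computability.Cryptography

end
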